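import Summits.ValiantsHypothesis.ValiantsHypothesis.Theorems.NewtonUnitEquationsTwoProductsTowerRecordDefs
import Summits.ValiantsHypothesis.ValiantsHypothesis.Theorems.NewtonUnitEquationsTwoProductsMomentRecordCells

/-!
# R13-coeff — CELLS of the real weight plane for a finite family of INTEGER forms; the tower families `±d`, `x_a − x_b + j•d`

(3/6) Cells `cellZ δ ξ` of a real weight `ξ` w.r.t. a finite family `δ : ι → ℤ²` (sign pattern + position of the slope among the critical values
`cvZ`), `≤ 32(|ι|+1)` of them, and ★ `nonneg_wtZ_iff_of_cellZ_eq`: the sign of EVERY form of the family is constant on a cell (all real weights, all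
signs).  The dense tower family `tfam x d L₀` (`d`, `−d`, `x_a − x_b + (e−L₀)•d`, `|TIdx| = 2 + n²(2L₀+1)`) and the sparse one `tfamG x d J`
(`j ∈ J`, `|TIdxG| = 2 + n²|J|`) with their sign transfers.  The five generic real-ratio lemmas (`lt_of_card_filter_lt_eq`, `eq_of_cell_eq`,
`trichotomy_of_cell_eq`, `ratio_le_transfer`, `ratio_ge_transfer`) are the tree's ✓ `…MomentRecordCells` ones BY NAME (imported, not restated).
Transplant (val-lit-p3 g18) of val-idea-37 g4's kernel-checked scratch `Cruxes/TwoProducts/TowerRecords_val_idea_37_g4.lean` (rev 3,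
sha16 988768bd6d8db99a, ns `ValIdea37g4T`; val-idea-crit-8 g2 VERDICT #19 + addendum: KEEP «R13-coeff», by-name GO for a verbatim transplant);
proofs verbatim by name, docstrings added, namespace = the tree's.  Helper on crux `stmt-ValiantsHypothesis-5906` (`TwoProducts`, line
`relation_ladder`); `--supports`, closes nothing by itself.  HONEST LABEL (crit-8 #19): COEFFICIENT-SIDE; the class rung it feeds (R13, dense
parallel towers on dissociated carriers) is a wider CLASS rung, inert as a hatch; F10's collinear digit towers NOT covered; `ResidualLawV24` ⟺
`PlanarCellBound`, the crux (stmt-5906), every `closes` binder and every summit statement UNMOVED; VP ≠ VNP is NOT proved.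
Credit: mathematics and kernel proofs val-idea-37 g4; critic of record val-idea-crit-8 g2.  No instances, no notation, no named facts. [folklore]
-/

set_option linter.dupNamespace false

noncomputable section

open Classical

namespace Summit.ValiantsHypothesis.ValiantsHypothesis.Theorems.NewtonUnitEquations.TwoProducts.TowerRecord

open scoped BigOperators
open Module Polynomial
open Summit.ValiantsHypothesis.ValiantsHypothesis.Theorems.NewtonUnitEquations.TwoProducts.FormalLogLinearisation
open Summit.ValiantsHypothesis.ValiantsHypothesis.Theorems.NewtonUnitEquations.TwoProducts.MomentRecord
open Summit.ValiantsHypothesis.ValiantsHypothesis.Theorems.NewtonUnitEquations.TwoProducts.PlanarCell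

variable {m n : ℕ}

/-! ## 5. Cells of the real weight plane deciding the signs of finitely many integer linear forms -/

section Cells

/-- Critical ratio of an integer vector `δ`: `0 ≤ ξ·δ ⇔ ξ₀ (−δ₀) ≤ ξ₁ δ₁`, critical value `δ₁ / (−δ₀)`. -/
def cvZ (δ : Fin 2 → ℤ) : ℝ := ((δ 1 : ℤ) : ℝ) / (-((δ 0 : ℤ) : ℝ))

variable {ι : Type*} [Fintype ι]

/-- The critical values of a finite family of integer vectors. [folklore] -/
def critSetZ (δ : ι → Fin 2 → ℤ) : Finset ℝ := Finset.univ.image fun i => cvZ (δ i)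

/-- The CELL of a real weight w.r.t. a finite family of integer vectors. -/
def cellZ (δ : ι → Fin 2 → ℤ) (ξ : Fin 2 → ℝ) : (Bool × Bool × Bool × Bool) × ℕ × Bool :=
  ((decide (0 < ξ 1), decide (ξ 1 < 0), decide (0 < ξ 0), decide (ξ 0 < 0)),
    ((critSetZ δ).filter fun q => q < ξ 0 / ξ 1).card, decide (ξ 0 / ξ 1 ∈ critSetZ δ))

/-- The finite set of cells of a family (sign pattern of `ξ`, position of `ξ₁/ξ₀` among the critical values). [folklore] -/
def cellSetZ (δ : ι → Fin 2 → ℤ) : Finset ((Bool × Bool × Bool × Bool) × ℕ × Bool) :=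
  Finset.univ ×ˢ (Finset.range ((critSetZ δ).card + 1) ×ˢ Finset.univ)

/-- Every weight lies in a cell of the family. [folklore] -/
theorem cellZ_mem_cellSetZ (δ : ι → Fin 2 → ℤ) (ξ : Fin 2 → ℝ) : cellZ δ ξ ∈ cellSetZ δ := by
  simp only [cellSetZ, cellZ, Finset.mem_product, Finset.mem_univ, Finset.mem_range, true_and, and_true]
  exact Nat.lt_succ_of_le (Finset.card_filter_le _ _)

/-- At most `|ι|` critical values. [folklore] -/
theorem card_critSetZ_le (δ : ι → Fin 2 → ℤ) : (critSetZ δ).card ≤ Fintype.card ι :=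
  Finset.card_image_le.trans (by rw [Finset.card_univ])

/-- At most `32(|ι|+1)` cells. [folklore] -/
theorem card_cellSetZ_le (δ : ι → Fin 2 → ℤ) : (cellSetZ δ).card ≤ 32 * (Fintype.card ι + 1) := by
  have hQ := card_critSetZ_le δ
  simp only [cellSetZ, Finset.card_product, Finset.card_univ, Fintype.card_prod, Fintype.card_bool,
    Finset.card_range]
  linarith

/-- `0 ≤ ξ·δ ⇔ ξ₀·(−δ₀) ≤ ξ₁·δ₁`. [folklore] -/
theorem nonneg_wtZ_iff_sub (ξ : Fin 2 → ℝ) (δ : Fin 2 → ℤ) :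
    0 ≤ wtZ ξ δ ↔ ξ 0 * (-((δ 0 : ℤ) : ℝ)) ≤ ξ 1 * ((δ 1 : ℤ) : ℝ) := by
  simp only [wtZ]
  constructor <;> intro h <;> linarith

/-- **Same cell ⇒ same sign of every form of the family** (real weights, all signs). -/
theorem nonneg_wtZ_iff_of_cellZ_eq (δ : ι → Fin 2 → ℤ) {ξ ξ' : Fin 2 → ℝ} (h : cellZ δ ξ = cellZ δ ξ') (i : ι) :
    (0 ≤ wtZ ξ (δ i) ↔ 0 ≤ wtZ ξ' (δ i)) := by
  simp only [cellZ, Prod.mk.injEq, decide_eq_decide] at h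
  obtain ⟨⟨h1p, h1n, h0p, h0n⟩, hcard, hmem⟩ := h
  rw [nonneg_wtZ_iff_sub ξ, nonneg_wtZ_iff_sub ξ']
  set u : ℝ := -((δ i 0 : ℤ) : ℝ) with hu
  set v : ℝ := ((δ i 1 : ℤ) : ℝ) with hv
  have hq : cvZ (δ i) ∈ critSetZ δ := Finset.mem_image.mpr ⟨i, Finset.mem_univ _, rfl⟩
  have hcrit : cvZ (δ i) = v / u := rfl
  obtain ⟨hlt, heq⟩ := trichotomy_of_cell_eq (critSetZ δ) (ξ 0 / ξ 1) (ξ' 0 / ξ' 1) hcard hmem hq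
  rw [hcrit] at hlt heq
  rcases lt_trichotomy 0 (ξ 1) with h1 | h1 | h1
  · have key : ∀ η : Fin 2 → ℝ, 0 < η 1 → (η 0 * u ≤ η 1 * v ↔ η 0 / η 1 * u ≤ v) := fun η hη => by
      rw [div_mul_eq_mul_div, div_le_iff₀ hη, mul_comm (η 1) v]
    rw [key ξ h1, key ξ' (h1p.mp h1)]
    exact ratio_le_transfer _ _ u v fun _ => ⟨hlt, heq⟩
  · have hξ1 : ξ 1 = 0 := h1.symm
    have hξ1' : ξ' 1 = 0 := by
      rcases lt_trichotomy (ξ' 1) 0 with hh | hh | hh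
      · exact absurd (h1n.mpr hh) (by rw [hξ1]; exact lt_irrefl 0)
      · exact hh
      · exact absurd (h1p.mpr hh) (by rw [hξ1]; exact lt_irrefl 0)
    rw [hξ1, hξ1', zero_mul]
    have epos : ∀ c : ℝ, 0 < c → (c * u ≤ 0 ↔ u ≤ 0) := fun c hc =>
      ⟨fun h => not_lt.mp fun hu' => (not_lt.mpr h) (mul_pos hc hu'),
        fun h => by simpa using mul_le_mul_of_nonneg_left h hc.le⟩
    have eneg : ∀ c : ℝ, c < 0 → (c * u ≤ 0 ↔ 0 ≤ u) := fun c hc =>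
      ⟨fun h => not_lt.mp fun hu' => (not_lt.mpr h) (mul_pos_of_neg_of_neg hc hu'),
        fun h => by simpa using mul_le_mul_of_nonneg_right hc.le h⟩
    rcases lt_trichotomy 0 (ξ 0) with h0 | h0 | h0
    · rw [epos _ h0, epos _ (h0p.mp h0)]
    · have hξ0 : ξ 0 = 0 := h0.symm
      have hξ0' : ξ' 0 = 0 := by
        rcases lt_trichotomy (ξ' 0) 0 with hh | hh | hh
        · exact absurd (h0n.mpr hh) (by rw [hξ0]; exact lt_irrefl 0)
        · exact hh
        · exact absurd (h0p.mpr hh) (by rw [hξ0]; exact lt_irrefl 0)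
      rw [hξ0, hξ0']
    · rw [eneg _ h0, eneg _ (h0n.mp h0)]
  · have key : ∀ η : Fin 2 → ℝ, η 1 < 0 → (η 0 * u ≤ η 1 * v ↔ v ≤ η 0 / η 1 * u) := fun η hη => by
      rw [div_mul_eq_mul_div, le_div_iff_of_neg hη, mul_comm (η 1) v]
    rw [key ξ h1, key ξ' (h1n.mp h1)]
    exact ratio_ge_transfer _ _ u v fun _ => ⟨hlt, heq⟩

end Cells

/-! ## 6. The tower family of forms: `±d` and `x_a − x_b + j d`, `|j| ≤ L₀` -/

/-- Index of the tower family. -/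
abbrev TIdx (n L₀ : ℕ) := Bool ⊕ ((Fin n × Fin n) × Fin (2 * L₀ + 1))

/-- The tower family of integer forms: `d`, `−d`, and `x_a − x_b + (e − L₀) d`. -/
def tfam (x : Fin n → Expo) (d : Fin 2 → ℤ) (L₀ : ℕ) : TIdx n L₀ → Fin 2 → ℤ
  | Sum.inl true => d
  | Sum.inl false => -d
  | Sum.inr ((a, b), e) => fun c => ((x a c : ℕ) : ℤ) - ((x b c : ℕ) : ℤ) + ((e : ℕ) - (L₀ : ℤ)) * d c

/-- Weight of the form `x_a − x_b + (e − L₀)•d`. [folklore] -/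
theorem wtZ_tfam_inr (ξ : Fin 2 → ℝ) (x : Fin n → Expo) (d : Fin 2 → ℤ) (L₀ : ℕ) (a b : Fin n) (e : Fin (2 * L₀ + 1)) :
    wtZ ξ (tfam x d L₀ (Sum.inr ((a, b), e))) = wt ξ (x a) - wt ξ (x b) + (((e : ℕ) : ℝ) - L₀) * wtZ ξ d := by
  simp only [wtZ, wt, tfam]
  push_cast
  ring

/-- Weight of the form `d`. [folklore] -/
theorem wtZ_tfam_true (ξ : Fin 2 → ℝ) (x : Fin n → Expo) (d : Fin 2 → ℤ) (L₀ : ℕ) :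
    wtZ ξ (tfam x d L₀ (Sum.inl true)) = wtZ ξ d := rfl

/-- Weight of the form `−d`. [folklore] -/
theorem wtZ_tfam_false (ξ : Fin 2 → ℝ) (x : Fin n → Expo) (d : Fin 2 → ℤ) (L₀ : ℕ) :
    wtZ ξ (tfam x d L₀ (Sum.inl false)) = - wtZ ξ d := by
  simp only [wtZ, tfam, Pi.neg_apply]
  push_cast
  ring

/-- `|TIdx n L₀| = 2 + n²(2L₀+1)`. [folklore] -/
theorem card_TIdx (n L₀ : ℕ) : Fintype.card (TIdx n L₀) = 2 + n * n * (2 * L₀ + 1) := by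
  simp only [TIdx, Fintype.card_sum, Fintype.card_bool, Fintype.card_prod, Fintype.card_fin]

/-- Signs of `ξ·d` agree on a cell. -/
theorem sign_transfer (x : Fin n → Expo) (d : Fin 2 → ℤ) (L₀ : ℕ) {ξ ξ' : Fin 2 → ℝ}
    (h : cellZ (tfam x d L₀) ξ = cellZ (tfam x d L₀) ξ') :
    (0 < wtZ ξ d → 0 < wtZ ξ' d) ∧ (wtZ ξ d < 0 → wtZ ξ' d < 0) ∧ (wtZ ξ d = 0 → wtZ ξ' d = 0) := by
  have hp := nonneg_wtZ_iff_of_cellZ_eq (tfam x d L₀) h (Sum.inl true)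
  have hn := nonneg_wtZ_iff_of_cellZ_eq (tfam x d L₀) h (Sum.inl false)
  rw [wtZ_tfam_true, wtZ_tfam_true] at hp
  rw [wtZ_tfam_false, wtZ_tfam_false] at hn
  refine ⟨fun hc => ?_, fun hc => ?_, fun hc => ?_⟩
  · by_contra hle
    have : 0 ≤ -wtZ ξ d := hn.mpr (by linarith [not_lt.mp hle])
    linarith
  · by_contra hle
    have : 0 ≤ wtZ ξ' d := not_lt.mp hle
    have := hp.mpr this
    linarith
  · have h1 : 0 ≤ wtZ ξ' d := hp.mp (le_of_eq hc.symm)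
    have h2 : 0 ≤ -wtZ ξ' d := hn.mp (by linarith)
    linarith

/-! ## 6b. The sparse tower family: `±d` and `x_a − x_b + j•d`, `j ∈ J` (source §10) -/

/-- Index of the sparse family: `±d` and `x_a − x_b + j•d`, `j ∈ J`. -/
abbrev TIdxG (n : ℕ) (J : Finset ℤ) := Bool ⊕ ((Fin n × Fin n) × ↥J)

/-- The sparse tower family of integer forms: `d`, `−d`, and `x_a − x_b + j•d`, `j ∈ J`. [folklore] -/
def tfamG (x : Fin n → Expo) (d : Fin 2 → ℤ) (J : Finset ℤ) : TIdxG n J → Fin 2 → ℤ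
  | Sum.inl true => d
  | Sum.inl false => -d
  | Sum.inr ((a, b), j) => fun c => ((x a c : ℕ) : ℤ) - ((x b c : ℕ) : ℤ) + (j : ℤ) * d c

/-- Weight of the form `x_a − x_b + j•d`. [folklore] -/
theorem wtZ_tfamG_inr (ξ : Fin 2 → ℝ) (x : Fin n → Expo) (d : Fin 2 → ℤ) (J : Finset ℤ) (a b : Fin n) (j : ↥J) :
    wtZ ξ (tfamG x d J (Sum.inr ((a, b), j))) = wt ξ (x a) - wt ξ (x b) + ((j : ℤ) : ℝ) * wtZ ξ d := by
  simp only [wtZ, wt, tfamG]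
  push_cast
  ring

/-- Weight of the form `d` (sparse family). [folklore] -/
theorem wtZ_tfamG_true (ξ : Fin 2 → ℝ) (x : Fin n → Expo) (d : Fin 2 → ℤ) (J : Finset ℤ) :
    wtZ ξ (tfamG x d J (Sum.inl true)) = wtZ ξ d := rfl

/-- Weight of the form `−d` (sparse family). [folklore] -/
theorem wtZ_tfamG_false (ξ : Fin 2 → ℝ) (x : Fin n → Expo) (d : Fin 2 → ℤ) (J : Finset ℤ) :
    wtZ ξ (tfamG x d J (Sum.inl false)) = - wtZ ξ d := by
  simp only [wtZ, tfamG, Pi.neg_apply]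
  push_cast
  ring

/-- `|TIdxG n J| = 2 + n²|J|`. [folklore] -/
theorem card_TIdxG (n : ℕ) (J : Finset ℤ) : Fintype.card (TIdxG n J) = 2 + n * n * J.card := by
  simp only [TIdxG, Fintype.card_sum, Fintype.card_bool, Fintype.card_prod, Fintype.card_fin, Fintype.card_coe]

/-- Signs of `ξ·d` agree on a cell of the sparse family. [folklore] -/
theorem sign_transferG (x : Fin n → Expo) (d : Fin 2 → ℤ) (J : Finset ℤ) {ξ ξ' : Fin 2 → ℝ}
    (h : cellZ (tfamG x d J) ξ = cellZ (tfamG x d J) ξ') :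
    (0 < wtZ ξ d → 0 < wtZ ξ' d) ∧ (wtZ ξ d < 0 → wtZ ξ' d < 0) ∧ (wtZ ξ d = 0 → wtZ ξ' d = 0) := by
  have hp := nonneg_wtZ_iff_of_cellZ_eq (tfamG x d J) h (Sum.inl true)
  have hn := nonneg_wtZ_iff_of_cellZ_eq (tfamG x d J) h (Sum.inl false)
  rw [wtZ_tfamG_true, wtZ_tfamG_true] at hp
  rw [wtZ_tfamG_false, wtZ_tfamG_false] at hn
  refine ⟨fun hc => ?_, fun hc => ?_, fun hc => ?_⟩
  · by_contra hle
    have : 0 ≤ -wtZ ξ d := hn.mpr (by linarith [not_lt.mp hle])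
    linarith
  · by_contra hle
    have : 0 ≤ wtZ ξ' d := not_lt.mp hle
    have := hp.mpr this
    linarith
  · have h1 : 0 ≤ wtZ ξ' d := hp.mp (le_of_eq hc.symm)
    have h2 : 0 ≤ -wtZ ξ' d := hn.mp (by linarith)
    linarith


end Summit.ValiantsHypothesis.ValiantsHypothesis.Theorems.NewtonUnitEquations.TwoProducts.TowerRecord

end
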